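import Mathlib
import Summits.CriticalPhenomena.PercolationContinuityZ3.Theorems.PercNearOneGluingNoHeavyLowerTailOrientedAntipodalHallOmegaSocket

/-!
# The deformed Ω-socket: ANY independent vector family indexed by members ∪ pseudo-sets gives the Hall count

Helper file for crux `stmt-CriticalPhenomena-4575` (`NoHeavyLowerTail`, route `PercNearOneGluingNoHeavy`),
new-inequality factory seat `prim-ineq-gen-3` (gen 15).  Everything here is PROVED (a reduction).

Setting of `…OrientedAntipodalHallOmegaSocket`: `f : Finset α → Lab k` monotone, ground set `S`, `D` a family
of subsets of `S` with `f (S \ X) ≠ B`; `G = {F ⊆ S : f F = B, f (S \ F) ≠ B, F ⊆ S \ X for some X ∈ D}` the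
one-sided enlargement of the co-goods above `D`, `Ψ = {F ∈ G : f (S \ F) ≠ A}` its pseudo-class.

CONJECTURE Ω of gen 13 (plain vectors `χ_U` of members and pseudo-sets independent in `ℚ^G`) is FALSE
(`…OmegaCounterexample`, gen 14: directed 3-, 4-, 5-cycles of types).  Gen 15 observes that the one-parameter
DEFORMATION which keeps the plain member vectors but replaces the pseudo vector `χ_E` by `χ_E + c·δ_E`
(`δ_E` the coordinate vector of `E ∈ G`) survives both counterexample labelings, the exhaustive four-point
census and several thousand random labelings for every `c ∉ {0, 1, −1}` tried (CONJECTURE Ω_c, memo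
FINDINGS-gen15 in HOME `run/shared/lean/prim/prim-ineq-gen-3/`).  Since members are never in `G`, the deformed
vector is uniformly `χ_U + c·δ_U` (written inline as `chi G U + c • fun F => if ↑F = U then 1 else 0`).

* `card_le_card_goods_above_of_indep_family` — the socket for an ARBITRARY vector assignment
  `v : Finset α → Vec G`: if `v` is injective-and-independent on members ∪ pseudo-sets then `#D ≤ #goods above D`.
* `card_le_card_goods_above_of_indep_deformed`, `exists_injective_good_above_of_indep_deformed` — the
  instance `v U = χ_U + c·δ_U` (counting and SDR forms): the socket for CONJECTURE Ω_c.
-/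

namespace Summit.CriticalPhenomena.PercolationContinuityZ3.Theorems

namespace OrientedAntipodalHall

open Finset Module AntipodalStrongHarris AntipodalStrongHarris.Lab ThreeFamilyRank
open scoped FinsetFamily

variable {α : Type*} [DecidableEq α] {k : ℕ}

/-- **Socket for an arbitrary vector family.**  With `S, f, D, G, Ψ` as in
`card_le_card_goods_above_of_indep`: if SOME assignment `v` of vectors of `ℚ^G` to sets is linearly
independent on the family (complemented members of `D`) ∪ (pseudo-sets), then at least `#D` good sets lie
above members of `D`. -/
theorem card_le_card_goods_above_of_indep_family (S : Finset α) {f : Finset α → Lab k}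
    (D G Ψ : Finset (Finset α)) (hDS : ∀ X ∈ D, X ⊆ S) (hDb : ∀ X ∈ D, f (S \ X) ≠ bot)
    (hG : G = {F ∈ S.powerset | f F = bot ∧ f (S \ F) ≠ bot ∧ ∃ X ∈ D, F ⊆ S \ X})
    (hΨ : Ψ = {F ∈ G | f (S \ F) ≠ top}) (v : Finset α → Vec G)
    (hind : LinearIndependent ℚ fun U : ↥(D.image (fun X => S \ X) ∪ Ψ) => v (U : Finset α)) :
    #D ≤ #{U ∈ S.powerset | f U = top ∧ f (S \ U) = bot ∧ ∃ X ∈ D, X ⊆ U} := by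
  classical
  set M : Finset (Finset α) := D.image (fun X => S \ X) with hM
  set K : Finset (Finset α) := {F ∈ G | f (S \ F) = top} with hK
  have hinjD : Set.InjOn (fun X => S \ X) (D : Set (Finset α)) := by
    intro X₁ hX₁ X₂ hX₂ h
    have h₁ := Finset.sdiff_sdiff_eq_self (hDS X₁ hX₁)
    have h₂ := Finset.sdiff_sdiff_eq_self (hDS X₂ hX₂)
    simp only at h
    rw [← h₁, ← h₂, h]
  have hcardM : #M = #D := card_image_of_injOn hinjD
  have hdisj : Disjoint M Ψ := by
    rw [Finset.disjoint_left]
    intro U hUM hUΨ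
    obtain ⟨X, hX, rfl⟩ := mem_image.mp hUM
    rw [hΨ, mem_filter, hG, mem_filter] at hUΨ
    exact hDb X hX hUΨ.1.2.1
  have hcardU : #(M ∪ Ψ) = #D + #Ψ := by rw [card_union_of_disjoint hdisj, hcardM]
  have hle : #(M ∪ Ψ) ≤ #G := by
    have h := hind.fintype_card_le_finrank
    rw [finrank_Vec, Fintype.card_coe] at h
    exact h
  have hGsplit : #K + #Ψ = #G := by
    rw [hK, hΨ]
    exact card_filter_add_card_filter_not _
  have hDK : #D ≤ #K := by omega
  have hKS : ∀ F ∈ K, F ⊆ S := by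
    intro F hF
    rw [hK, mem_filter, hG, mem_filter, mem_powerset] at hF
    exact hF.1.1
  have hinjK : Set.InjOn (fun F => S \ F) (K : Set (Finset α)) := by
    intro F₁ hF₁ F₂ hF₂ h
    have h₁ := Finset.sdiff_sdiff_eq_self (hKS F₁ hF₁)
    have h₂ := Finset.sdiff_sdiff_eq_self (hKS F₂ hF₂)
    simp only at h
    rw [← h₁, ← h₂, h]
  have himg : K.image (fun F => S \ F) ⊆
      {U ∈ S.powerset | f U = top ∧ f (S \ U) = bot ∧ ∃ X ∈ D, X ⊆ U} := by
    intro U hU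
    obtain ⟨F, hF, rfl⟩ := mem_image.mp hU
    have hFS := hKS F hF
    rw [hK, mem_filter, hG, mem_filter] at hF
    obtain ⟨⟨-, hFbot, -, X, hX, hFX⟩, hFtop⟩ := hF
    rw [mem_filter, mem_powerset, Finset.sdiff_sdiff_eq_self hFS]
    refine ⟨sdiff_subset, hFtop, hFbot, X, hX, ?_⟩
    intro a ha
    exact mem_sdiff.mpr ⟨hDS X hX ha, fun haF => (mem_sdiff.mp (hFX haF)).2 ha⟩
  calc #D ≤ #K := hDK
    _ = #(K.image fun F => S \ F) := (card_image_of_injOn hinjK).symm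
    _ ≤ #{U ∈ S.powerset | f U = top ∧ f (S \ U) = bot ∧ ∃ X ∈ D, X ⊆ U} := card_le_card himg

/-- **Ω_c-socket, counting form.**  If for some `c : ℚ` the deformed vectors `χ_U + c·δ_U` of the
complemented members `S \ X` (`X ∈ D`; there `δ_U = 0`) and of the pseudo-sets are linearly independent in
`ℚ^G`, then at least `#D` good sets lie above members of `D`.  (`c = 0` is the Ω-socket.) -/
theorem card_le_card_goods_above_of_indep_deformed (S : Finset α) {f : Finset α → Lab k} (c : ℚ)
    (D G Ψ : Finset (Finset α)) (hDS : ∀ X ∈ D, X ⊆ S) (hDb : ∀ X ∈ D, f (S \ X) ≠ bot)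
    (hG : G = {F ∈ S.powerset | f F = bot ∧ f (S \ F) ≠ bot ∧ ∃ X ∈ D, F ⊆ S \ X})
    (hΨ : Ψ = {F ∈ G | f (S \ F) ≠ top})
    (hind : LinearIndependent ℚ fun U : ↥(D.image (fun X => S \ X) ∪ Ψ) =>
      chi G (U : Finset α) + c • (fun F : ↥G => if (F : Finset α) = (U : Finset α) then (1 : ℚ) else 0)) :
    #D ≤ #{U ∈ S.powerset | f U = top ∧ f (S \ U) = bot ∧ ∃ X ∈ D, X ⊆ U} :=
  card_le_card_goods_above_of_indep_family S D G Ψ hDS hDb hG hΨ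
    (fun U => chi G U + c • (fun F : ↥G => if (F : Finset α) = U then (1 : ℚ) else 0)) hind

/-- **Ω_c-socket, SDR form.**  If for every sub-family of `D` some deformation parameter `c` makes the
deformed family independent, the members of `D` have DISTINCT good representatives above them. -/
theorem exists_injective_good_above_of_indep_deformed (S : Finset α) {f : Finset α → Lab k}
    (D : Finset (Finset α)) (hDS : ∀ X ∈ D, X ⊆ S) (hDb : ∀ X ∈ D, f (S \ X) ≠ bot)
    (hind : ∀ D' ⊆ D, ∀ G Ψ : Finset (Finset α),
      G = {F ∈ S.powerset | f F = bot ∧ f (S \ F) ≠ bot ∧ ∃ X ∈ D', F ⊆ S \ X} →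
      Ψ = {F ∈ G | f (S \ F) ≠ top} → ∃ c : ℚ,
      LinearIndependent ℚ fun U : ↥(D'.image (fun X => S \ X) ∪ Ψ) =>
        chi G (U : Finset α) + c • (fun F : ↥G => if (F : Finset α) = (U : Finset α) then (1 : ℚ) else 0)) :
    ∃ φ : D → Finset α, Function.Injective φ ∧
      ∀ X : D, (X : Finset α) ⊆ φ X ∧ φ X ⊆ S ∧ f (φ X) = top ∧ f (S \ φ X) = bot := by
  classical
  let t : D → Finset (Finset α) := fun X =>
    {U ∈ S.powerset | f U = top ∧ f (S \ U) = bot ∧ (X : Finset α) ⊆ U}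
  have hHall : ∀ s : Finset D, #s ≤ #(s.biUnion t) := by
    intro s
    set D' : Finset (Finset α) := s.map (Function.Embedding.subtype _) with hD'
    have hD'sub : D' ⊆ D := by
      intro X hX
      obtain ⟨x, -, rfl⟩ := mem_map.mp hX
      exact x.2
    have hcard : #s = #D' := (card_map _).symm
    obtain ⟨c, hc⟩ := hind D' hD'sub _ _ rfl rfl
    have hle := card_le_card_goods_above_of_indep_deformed S c D' _ _ (fun X hX => hDS X (hD'sub hX))
      (fun X hX => hDb X (hD'sub hX)) rfl rfl hc
    have hgoods : {U ∈ S.powerset | f U = top ∧ f (S \ U) = bot ∧ ∃ X ∈ D', X ⊆ U} ⊆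
        s.biUnion t := by
      intro U hU
      rw [mem_filter, mem_powerset] at hU
      obtain ⟨hUS, hUtop, hUbot, X, hX, hXU⟩ := hU
      obtain ⟨x, hx, rfl⟩ := mem_map.mp hX
      rw [mem_biUnion]
      refine ⟨x, hx, ?_⟩
      simp only [t, mem_filter, mem_powerset]
      exact ⟨hUS, hUtop, hUbot, hXU⟩
    calc #s = #D' := hcard
      _ ≤ #{U ∈ S.powerset | f U = top ∧ f (S \ U) = bot ∧ ∃ X ∈ D', X ⊆ U} := hle
      _ ≤ #(s.biUnion t) := card_le_card hgoods
  obtain ⟨φ, hφinj, hφ⟩ := (all_card_le_biUnion_card_iff_exists_injective t).mp hHall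
  refine ⟨φ, hφinj, fun X => ?_⟩
  have hX := hφ X
  simp only [t, mem_filter, mem_powerset] at hX
  exact ⟨hX.2.2.2, hX.1, hX.2.1, hX.2.2.1⟩

end OrientedAntipodalHall

end Summit.CriticalPhenomena.PercolationContinuityZ3.Theorems
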